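import Summits.Ventures.YMGap.RobustBall.PerturbedSmoothing
import Summits.Ventures.YMGap.RobustBall.MassGapOnBall
import Summits.Ventures.YMGap.Thresholds.MassGapAtMassive
import HarnessLib

/-!
# Venture YMGap, track ROBUST-BALL — the bridge «Lipschitz-cylinder clustering under a DLR state of a
# MEMBER of the `ℤ^d` ball ⇒ exponential clustering of ALL bounded measurable local observables»

HONEST FRAMING. WHAT THIS IS: a venture file (cell `pub-ymgap`, track Y2 ROBUST-BALL, seat ds-3),
strong-coupling LATTICE statement for `SU(N)` lattice Yang–Mills on `ℤ^d` with a PERTURBED action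
`N β S_W + W`, `(W, supp)` a member of rb-p1's tier-1 ball `MemBallZd ε₀ ε₁ R` (continuous adapted link
potential of range `R`, oscillation load `≤ ε₀`, cross-Lipschitz load `≤ ε₁` at every link). It is the
perturbed twin of the seat's Wilson bridge `Thresholds/MassGapAtMassive.lean`
(`covariance_decay_of_lipschitzClustering`): if a DLR state `μ` of `perturbedYM (fundamentalRep (Fin N)) b W supp`
satisfies the Shen–Zhu–Zhu clustering clause for LIPSCHITZ CYLINDER functions (the `μ`-clause of rb-p1's
`PerturbedMassGapAt`, rate `c`), then `cov_μ(F₁, F₂ ∘ θ_x)` decays at the SAME rate `c` for ALL bounded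
measurable local observables (`perturbed_covariance_decay_of_lipschitzClustering`, every `d ≥ 1`;
`perturbed_covariance_decay_of_memBallZd` packages the hypotheses from `MemBallZd`). WHAT IT IS NOT: no
new threshold or row; nothing about the continuum, confinement, a transfer-matrix gap or the Clay problem.

METHOD (all inputs are tree theorems). A DLR state reproduces the member's kernel averages
(`integral_specAvg`, `integral_specAvg_mul`, `isSpecification_perturbedYM`); once the `W`-COLLARS of `S₁`
and `S₂ − x` are disjoint (`‖x‖_∞ > D + 2r`, `r = max 1 ⌈R⌉₊`) the covariance of `F₁, F₂ ∘ θ_x` equals that of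
the smoothings `γ^W_{S₁} F₁`, `γ^W_{S₂−x}(F₂ ∘ θ_x)` — Lipschitz cylinder functions on the `W`-collars with
constants independent of `x` because the loads are PER LINK (`isLipschitzCylinder_specAvg_perturbedYM_card`,
moduli `#Sᵢ · ε₁`, collar size `(1 + m)#Sᵢ` with `m = 6(d−1) + #box(⌊R⌋₊)·d`), at edge distance
`≥ ‖x‖_∞ − (D + 2r)`; the near regime costs `2‖F₁‖_∞‖F₂‖_∞`.

References: H. Shen, R. Zhu, X. Zhu, CMP 400 (2023) 805–851, Thm. 1.2, Cor. 1.4; H.-O. Georgii,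
Gibbs Measures and Phase Transitions (2011), Def. 1.23, (2.15), Prop. 8.8; K. Osterwalder, E. Seiler,
Ann. Phys. 110 (1978) 440, §4; rb-theory `HOME/rb/ROBUST-BALL-DESIGN.md` v0.2 §3.2 (rb-ref F4).
-/

noncomputable section

open MeasureTheory ProbabilityTheory Function Finset Filter Topology
open scoped NNReal
open Literature.Probability.LatticeModels
open Literature.Probability.LatticeModels.DobrushinMetric
open Literature.MathematicalPhysics.QuantumLattice
open Literature.MathematicalPhysics.QuantumFieldTheory hiding ZdEdge
open Literature.MathematicalPhysics.QuantumFieldTheory.Balaban1983to89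
open Literature.MathematicalPhysics.QuantumFieldTheory.Balaban1983to89.StrongCouplingTorusWindow
open Literature.Barriers.QuantumFields (IsMassiveState)
open Summit.Ventures.YMGap.ZdSmoothing

namespace Summit.Ventures.YMGap.RobustBall

variable {d N : ℕ}

/-! ### Geometry of a support pair under translation with the `W`-collar (every `d`) -/

/-- Base points of the `W`-collars of `S₁` and of `S₂ − x`, the latter translated back by `x`, are within
`D + 2r` of each other in the sup norm, where `D` bounds `‖a₀ − b₀‖_∞` over `S₁ × S₂` and every
one-link range is based within `r` of its link (the range-`r` form of
`MassGapMassive.supNorm_le_of_mem_union_collar_dim`). -/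
theorem supNorm_le_of_mem_collar_pair {supp : Finset (ZdEdge d) → Finset (Finset (ZdEdge d))} {r : ℕ}
    (hr : ∀ e, ∀ y ∈ perturbedNbr supp e, ‖e.1 - y.1‖ ≤ (r : ℝ))
    {S₁ S₂ : Finset (ZdEdge d)} {D : ℕ}
    (hD : ∀ a₀ ∈ S₁, ∀ b₀ ∈ S₂, Site.supNorm (a₀.1 - b₀.1) ≤ D) (x : Site d) {a b : ZdEdge d}
    (ha : a ∈ S₁ ∪ S₁.biUnion (perturbedNbr supp))
    (hb : b ∈ S₂.image (fun e => (e.1 - x, e.2)) ∪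
      (S₂.image fun e => (e.1 - x, e.2)).biUnion (perturbedNbr supp)) :
    Site.supNorm (a.1 - (b.1 + x)) ≤ D + 2 * r := by
  obtain ⟨a₀, ha₀, hna⟩ := exists_near_of_mem_union_biUnion_perturbedNbr hr ha
  obtain ⟨b₀', hb₀', hnb⟩ := exists_near_of_mem_union_biUnion_perturbedNbr hr hb
  obtain ⟨b₀, hb₀, rfl⟩ := Finset.mem_image.1 hb₀'
  have hDab := hD a₀ ha₀ b₀ hb₀
  rw [Site.supNorm_le_iff]
  intro j
  have h1 := hna j
  have h2 := hnb j
  have h3 := (Site.natAbs_le_supNorm (a₀.1 - b₀.1) j).trans hDab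
  simp only [Pi.sub_apply, Pi.add_apply] at h1 h2 h3 ⊢
  rw [abs_le] at h1 h2
  omega

/-! ### The bridge: Lipschitz-cylinder clustering under a DLR state of a MEMBER ⇒ clustering of all bounded local observables -/

/-- **Covariance decay of ALL bounded measurable local observables under a DLR state of a member of the
`ℤ^d` ball, from the Shen–Zhu–Zhu clustering clause for Lipschitz cylinder functions** (`SU(N)`, every
`d ≥ 1`, tree coupling `b`). Let `W` be a link potential with measurable bounded terms depending only on
their own links, locally finitely supported by `supp`, with per-link Frobenius-Lipschitz witnesses `lip` of
cross load `≤ ε₁` at every link, every one-link range `perturbedNbr supp e` having at most `m` links based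
within `ℓ^∞`-distance `r` of `e`. If `μ` is a DLR state of `perturbedYM (fundamentalRep (Fin N)) b W supp`
under which, for some rate `c > 0` and every support size `n`, Lipschitz cylinder functions with disjoint
supports of size `≤ n` cluster as `|cov_μ(G₁,G₂)| ≤ c₁(n) e^{−c d(Λ₁,Λ₂)} (K₁K₂ + ‖G₁‖₂‖G₂‖₂)` (the
`μ`-clause of rb-p1's `PerturbedMassGapAt`), then for every pair of bounded measurable local observables
`F₁, F₂` there is `C` with `|cov_μ(F₁, F₂ ∘ θ_x)| ≤ C e^{−c‖x‖_∞}` for all `x ∈ ℤ^d` — the SAME rate `c`.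
Method: DLR smoothing over the supports; the smoothings are Lipschitz cylinder functions on the
`W`-collars (`isLipschitzCylinder_specAvg_perturbedYM_card`, constants uniform over translates because the
loads are per-link), disjoint and at edge distance `≥ ‖x‖_∞ − (D + 2r)` once `‖x‖_∞ > D + 2r`. -/
theorem perturbed_covariance_decay_of_lipschitzClustering (hd : 1 ≤ d) (hN : 1 ≤ N) (b : ℝ)
    {W : Potential (ZdEdge d) (Matrix.specialUnitaryGroup (Fin N) ℂ)}
    {supp : Finset (ZdEdge d) → Finset (Finset (ZdEdge d))}
    (hWm : ∀ X, Measurable (W X)) (hWb : ∀ X, ∃ C, ∀ U, |W X U| ≤ C)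
    (hWdep : ∀ X, DependsOn (W X) (↑X : Set (ZdEdge d))) (hsupp : W.IsSupportedBy supp)
    {lip : Finset (ZdEdge d) → ZdEdge d → ℝ} (hlip : ∀ X, IsLipBound suFrobDist (W X) (lip X)) {ε₁ : ℝ}
    (hΛ : ∀ e, ∑ y ∈ perturbedNbr supp e, ∑ X ∈ (supp {e}).filter (fun X => e ∈ X), lip X y ≤ ε₁)
    {m : ℕ} (hm : ∀ e, (perturbedNbr supp e).card ≤ m)
    {r : ℕ} (hr : ∀ e, ∀ y ∈ perturbedNbr supp e, ‖e.1 - y.1‖ ≤ (r : ℝ))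
    {μ : Measure (LGConfig d (Matrix.specialUnitaryGroup (Fin N) ℂ))}
    (hμ : μ ∈ perturbedGibbsMeasures (d := d) (fundamentalRep (Fin N)) b W supp) {c : ℝ} (hc : 0 < c)
    (hcl : ∀ n : ℕ, ∃ c₁ : ℝ,
      ∀ (G₁ G₂ : LGConfig d (Matrix.specialUnitaryGroup (Fin N) ℂ) → ℝ)
        (Λ₁ Λ₂ : Finset (ZdEdge d)) (K₁ K₂ : ℝ≥0),
        Λ₁.card ≤ n → Λ₂.card ≤ n → Disjoint Λ₁ Λ₂ →
        IsLipschitzCylinder (fundamentalRep (Fin N)) G₁ Λ₁ K₁ →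
        IsLipschitzCylinder (fundamentalRep (Fin N)) G₂ Λ₂ K₂ →
          |cov[G₁, G₂; μ]| ≤ c₁ * Real.exp (-c * setDistEdges Λ₁ Λ₂) *
            ((K₁ : ℝ) * K₂ + Real.sqrt (∫ U, G₁ U ^ 2 ∂μ) * Real.sqrt (∫ U, G₂ U ^ 2 ∂μ)))
    (F₁ F₂ : LGConfig d (Matrix.specialUnitaryGroup (Fin N) ℂ) → ℝ)
    (h₁ : Literature.MathematicalPhysics.QuantumLattice.IsLocalObservable F₁)
    (h₂ : Literature.MathematicalPhysics.QuantumLattice.IsLocalObservable F₂) (h₁m : Measurable F₁) (h₂m : Measurable F₂)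
    (hb₁ : ∃ C, ∀ U, |F₁ U| ≤ C) (hb₂ : ∃ C, ∀ U, |F₂ U| ≤ C) :
    ∃ C : ℝ, ∀ x : Site d, |cov[F₁, fun U => F₂ (Literature.MathematicalPhysics.QuantumLattice.configShift x U); μ]| ≤ C * Real.exp (-c * ‖x‖) := by
  classical
  haveI : SecondCountableTopology (Matrix (Fin N) (Fin N) ℂ) :=
    inferInstanceAs (SecondCountableTopology (Fin N → Fin N → ℂ))
  haveI : SecondCountableTopology (Matrix.specialUnitaryGroup (Fin N) ℂ) :=
    Topology.IsEmbedding.subtypeVal.secondCountableTopology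
  have hρc := continuous_fundamentalRep (Fin N)
  set γ := perturbedYM (d := d) (fundamentalRep (Fin N)) b W supp with hγdef
  have hW : W.IsAdapted := fun X => ⟨hWdep X, hWm X⟩
  have hγ : IsSpecification γ := isSpecification_perturbedYM _ hρc _ hW hWb hsupp
  have hGibbs : IsGibbsMeasure γ μ := hμ
  haveI : IsProbabilityMeasure μ := hGibbs.isProbabilityMeasure
  -- supports (made non-empty by adjoining one fixed link) and bounds
  obtain ⟨S₁', hS₁'⟩ := h₁
  obtain ⟨S₂', hS₂'⟩ := h₂
  obtain ⟨M₁, hM₁⟩ := hb₁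
  obtain ⟨M₂, hM₂⟩ := hb₂
  set e₀ : ZdEdge d := ((0 : Site d), (⟨0, hd⟩ : Fin d)) with he₀
  set S₁ : Finset (ZdEdge d) := insert e₀ S₁' with hS₁def
  set S₂ : Finset (ZdEdge d) := insert e₀ S₂' with hS₂def
  have hS₁ : IsCylinder F₁ S₁ :=
    DependsOn.mono (fun e he => Finset.mem_coe.2 (Finset.mem_insert_of_mem (Finset.mem_coe.1 he))) hS₁'
  have hS₂ : IsCylinder F₂ S₂ :=
    DependsOn.mono (fun e he => Finset.mem_coe.2 (Finset.mem_insert_of_mem (Finset.mem_coe.1 he))) hS₂'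
  have hS₁ne : S₁.Nonempty := Finset.insert_nonempty _ _
  have hS₂ne : S₂.Nonempty := Finset.insert_nonempty _ _
  have hM₁0 : 0 ≤ M₁ := (abs_nonneg _).trans (hM₁ fun _ => 1)
  have hM₂0 : 0 ≤ M₂ := (abs_nonneg _).trans (hM₂ fun _ => 1)
  have hlip0 : ∀ X z, 0 ≤ lip X z := fun X z => (hlip X).nonneg z
  have hε₁ : 0 ≤ ε₁ :=
    (Finset.sum_nonneg fun y' _ => Finset.sum_nonneg fun X _ => hlip0 X y').trans (hΛ e₀)
  have hD : ∀ a₀ ∈ S₁, ∀ b₀ ∈ S₂, Site.supNorm (a₀.1 - b₀.1) ≤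
      (S₁ ×ˢ S₂).sup fun ab => Site.supNorm (ab.1.1 - ab.2.1) :=
    fun a₀ ha₀ b₀ hb₀ => Finset.le_sup
      (f := fun ab : ZdEdge d × ZdEdge d => Site.supNorm (ab.1.1 - ab.2.1))
      (Finset.mk_mem_product ha₀ hb₀)
  generalize ((S₁ ×ˢ S₂).sup fun ab => Site.supNorm (ab.1.1 - ab.2.1)) = D at hD
  set n : ℕ := (1 + m) * S₁.card + (1 + m) * S₂.card with hndef
  obtain ⟨c₁, hc₁⟩ := hcl n
  set c₁' : ℝ := max c₁ 0 with hc₁'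
  have hc₁'0 : 0 ≤ c₁' := le_max_right _ _
  -- the smoothing Lipschitz factors at the moduli `ℓᵢ = #Sᵢ · ε₁`
  set E₁ : ℝ := (Real.exp (2 * Real.sqrt N *
    (2 * (((2 * (d - 1) : ℕ) : ℝ) * (|b| * Real.sqrt N) + S₁.card * ε₁))) - 1) / (2 * Real.sqrt N) with hE₁
  set E₂ : ℝ := (Real.exp (2 * Real.sqrt N *
    (2 * (((2 * (d - 1) : ℕ) : ℝ) * (|b| * Real.sqrt N) + S₂.card * ε₁))) - 1) / (2 * Real.sqrt N) with hE₂
  set K₁ : ℝ≥0 := (((((1 + m) * S₁.card : ℕ) : ℝ)) * N * (M₁ * E₁)).toNNReal with hK₁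
  set K₂ : ℝ≥0 := (((((1 + m) * S₂.card : ℕ) : ℝ)) * N * (M₂ * E₂)).toNNReal with hK₂
  set Kfar : ℝ := Real.exp (c * ((D + 2 * r : ℕ) : ℝ)) with hKfar
  have hKfar0 : 0 < Kfar := Real.exp_pos _
  set A : ℝ := c₁' * ((K₁ : ℝ) * K₂ + M₁ * M₂) with hAdef
  have hA0 : 0 ≤ A := by positivity
  refine ⟨(2 * M₁ * M₂ + A) * Kfar, fun x => ?_⟩
  set Gx : LGConfig d (Matrix.specialUnitaryGroup (Fin N) ℂ) → ℝ := F₂ ∘ Literature.MathematicalPhysics.QuantumLattice.configShift x with hGxdef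
  obtain ⟨S₂x, hS₂x⟩ : ∃ S : Finset (ZdEdge d), S = S₂.image fun e => (e.1 - x, e.2) := ⟨_, rfl⟩
  have hGxS : IsCylinder Gx S₂x := by rw [hS₂x]; exact IsCylinder.comp_configShift hS₂ x
  have hGxm : Measurable Gx := h₂m.comp (Literature.MathematicalPhysics.QuantumLattice.configShift x).measurable
  have hGxM : ∀ U, |Gx U| ≤ M₂ := fun U => hM₂ _
  have hS₂xcard : S₂x.card ≤ S₂.card := by rw [hS₂x]; exact Finset.card_image_le
  have hL2 : ∀ {f : LGConfig d (Matrix.specialUnitaryGroup (Fin N) ℂ) → ℝ} {M : ℝ}, Measurable f →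
      (∀ U, |f U| ≤ M) → MemLp f 2 μ := fun hf hfM =>
    memLp_of_bounded (ae_of_all _ fun U => abs_le.1 (hfM U)) hf.aestronglyMeasurable 2
  have hcov : cov[F₁, fun U => F₂ (Literature.MathematicalPhysics.QuantumLattice.configShift x U); μ] =
      (∫ U, F₁ U * Gx U ∂μ) - (∫ U, F₁ U ∂μ) * ∫ U, Gx U ∂μ :=
    covariance_eq_sub (hL2 h₁m hM₁) (hL2 hGxm hGxM)
  have hexp0 : 0 < Real.exp (-c * (Site.supNorm x : ℕ)) := Real.exp_pos _
  rw [Site.norm_eq_supNorm x]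
  by_cases hnear : Site.supNorm x ≤ D + 2 * r
  · -- NEAR: the trivial bound `|cov| ≤ 2 M₁ M₂` and `Kfar e^{-c ‖x‖} ≥ 1`
    rw [hcov]
    have htriv : |(∫ U, F₁ U * Gx U ∂μ) - (∫ U, F₁ U ∂μ) * ∫ U, Gx U ∂μ| ≤ 2 * M₁ * M₂ := by
      refine (abs_sub _ _).trans ?_
      have e1 := StrongCouplingTorusWindow.abs_integral_le_of_abs_le (μ := μ) (abs_mul_le_of_abs_le hM₁ hGxM)
      have e2 : |(∫ U, F₁ U ∂μ) * ∫ U, Gx U ∂μ| ≤ M₁ * M₂ := by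
        rw [abs_mul]
        exact mul_le_mul (StrongCouplingTorusWindow.abs_integral_le_of_abs_le hM₁)
          (StrongCouplingTorusWindow.abs_integral_le_of_abs_le hGxM)
          (abs_nonneg _) hM₁0
      linarith
    have hone : 1 ≤ Kfar * Real.exp (-c * (Site.supNorm x : ℕ)) := by
      rw [hKfar, ← Real.exp_add]
      refine Real.one_le_exp ?_
      have : ((Site.supNorm x : ℕ) : ℝ) ≤ ((D + 2 * r : ℕ) : ℝ) := by exact_mod_cast hnear
      have := mul_le_mul_of_nonneg_left this hc.le
      linarith
    refine htriv.trans ?_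
    have h2MM : 0 ≤ 2 * M₁ * M₂ := by positivity
    calc 2 * M₁ * M₂ ≤ 2 * M₁ * M₂ * (Kfar * Real.exp (-c * (Site.supNorm x : ℕ))) :=
          le_mul_of_one_le_right h2MM hone
      _ ≤ (2 * M₁ * M₂ + A) * (Kfar * Real.exp (-c * (Site.supNorm x : ℕ))) :=
          mul_le_mul_of_nonneg_right (le_add_of_nonneg_right hA0) (mul_nonneg hKfar0.le hexp0.le)
      _ = (2 * M₁ * M₂ + A) * Kfar * Real.exp (-c * (Site.supNorm x : ℕ)) := by ring
  -- FAR: `D + 2r < ‖x‖_∞`; DLR smoothing of both observables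
  rw [not_le] at hnear
  set f₁ : LGConfig d (Matrix.specialUnitaryGroup (Fin N) ℂ) → ℝ := specAvg γ S₁ F₁ with hf₁def
  set g₂ : LGConfig d (Matrix.specialUnitaryGroup (Fin N) ℂ) → ℝ := specAvg γ S₂x Gx with hg₂def
  have hf₁m : Measurable f₁ := measurable_specAvg hγ S₁ h₁m
  have hg₂m : Measurable g₂ := measurable_specAvg hγ S₂x hGxm
  have hf₁M : ∀ U, |f₁ U| ≤ M₁ := abs_specAvg_le hγ S₁ hM₁
  have hg₂M : ∀ U, |g₂ U| ≤ M₂ := abs_specAvg_le hγ S₂x hGxM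
  obtain ⟨T₁, hT₁⟩ : ∃ T : Finset (ZdEdge d), T = S₁ ∪ S₁.biUnion (perturbedNbr supp) := ⟨_, rfl⟩
  obtain ⟨T₂, hT₂⟩ : ∃ T : Finset (ZdEdge d), T = S₂x ∪ S₂x.biUnion (perturbedNbr supp) := ⟨_, rfl⟩
  have hf₁T : IsCylinder f₁ T₁ := by
    rw [hT₁]
    exact dependsOn_specAvg_perturbedYM_collar (fundamentalRep (Fin N)) hρc b hWm hWdep hsupp S₁ h₁m hS₁
  have hg₂T : IsCylinder g₂ T₂ := by
    rw [hT₂]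
    exact dependsOn_specAvg_perturbedYM_collar (fundamentalRep (Fin N)) hρc b hWm hWdep hsupp S₂x hGxm hGxS
  -- the Hamiltonians are Lipschitz in the outside links with the moduli `#Sᵢ · ε₁`
  have hH₁ : ∀ y, y ∉ S₁ → ∀ U V : LGConfig d (Matrix.specialUnitaryGroup (Fin N) ℂ),
      (∀ z, z ≠ y → U z = V z) →
        |hamiltonianIn W supp S₁ U - hamiltonianIn W supp S₁ V| ≤ S₁.card * ε₁ * suFrobDist (U y) (V y) :=
    fun y hy U V hUV => abs_hamiltonianIn_sub_le_of_eq_off hWdep hsupp hlip hΛ S₁ hy hUV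
  have hH₂ : ∀ y, y ∉ S₂x → ∀ U V : LGConfig d (Matrix.specialUnitaryGroup (Fin N) ℂ),
      (∀ z, z ≠ y → U z = V z) →
        |hamiltonianIn W supp S₂x U - hamiltonianIn W supp S₂x V| ≤ S₂.card * ε₁ * suFrobDist (U y) (V y) :=
    fun y hy U V hUV => (abs_hamiltonianIn_sub_le_of_eq_off hWdep hsupp hlip hΛ S₂x hy hUV).trans
      (mul_le_mul_of_nonneg_right (mul_le_mul_of_nonneg_right (by exact_mod_cast hS₂xcard) hε₁)
        (suFrobDist_nonneg _ _))
  have hℓ₁ : (0 : ℝ) ≤ S₁.card * ε₁ := mul_nonneg (Nat.cast_nonneg _) hε₁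
  have hℓ₂ : (0 : ℝ) ≤ S₂.card * ε₁ := mul_nonneg (Nat.cast_nonneg _) hε₁
  -- the smoothings are Lipschitz cylinder functions with the displacement-free constants `K₁`, `K₂`
  have hf₁L : IsLipschitzCylinder (fundamentalRep (Fin N)) f₁ T₁ K₁ := by
    rw [hT₁]
    exact isLipschitzCylinder_specAvg_perturbedYM_card hN b hWm hWb hWdep hsupp S₁ hℓ₁ hH₁ h₁m hS₁ hM₁
      hm le_rfl
  have hg₂L : IsLipschitzCylinder (fundamentalRep (Fin N)) g₂ T₂ K₂ := by
    rw [hT₂]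
    exact isLipschitzCylinder_specAvg_perturbedYM_card hN b hWm hWb hWdep hsupp S₂x hℓ₂ hH₂ hGxm hGxS
      hGxM hm hS₂xcard
  -- geometry: base points of `T₁` and `T₂ + x` are within `D + 2r`; hence `T₁ ∩ T₂ = ∅` and
  -- `d(T₁, T₂) ≥ ‖x‖_∞ − (D + 2r)`
  have hxD : ∀ a ∈ T₁, ∀ b' ∈ T₂, Site.supNorm (a.1 - (b'.1 + x)) ≤ D + 2 * r := by
    intro a ha b' hb
    rw [hT₁] at ha
    rw [hT₂, hS₂x] at hb
    exact supNorm_le_of_mem_collar_pair hr hD x ha hb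
  have hdisj : ∀ a ∈ T₁, ∀ b' ∈ T₂, a ≠ b' := by
    intro a ha b' hb hab
    subst hab
    have h := hxD a ha a hb
    have hax : a.1 - (a.1 + x) = -x := sub_add_cancel_left a.1 x
    have hneg : Site.supNorm (-x) = Site.supNorm x := by
      simp only [Site.supNorm, Pi.neg_apply, Int.natAbs_neg]
    rw [hax, hneg] at h
    omega
  have hdisjT : Disjoint T₁ T₂ := Finset.disjoint_left.2 fun a ha hb => hdisj a ha a hb rfl
  have hT₁ne : T₁.Nonempty := by
    rw [hT₁]; exact hS₁ne.mono Finset.subset_union_left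
  have hT₂ne : T₂.Nonempty := by
    rw [hT₂]
    have : S₂x.Nonempty := by rw [hS₂x]; exact hS₂ne.image _
    exact this.mono Finset.subset_union_left
  have hdist : ((Site.supNorm x : ℕ) : ℝ) - ((D + 2 * r : ℕ) : ℝ) ≤ setDistEdges T₁ T₂ := by
    refine le_setDistEdges_of_forall hT₁ne hT₂ne fun a ha b' hb => ?_
    have h1 : ‖a.1 - (b'.1 + x)‖ ≤ ((D + 2 * r : ℕ) : ℝ) := by
      rw [Site.norm_eq_supNorm]; exact_mod_cast hxD a ha b' hb
    have h2 : ‖x‖ ≤ ‖a.1 - b'.1‖ + ‖a.1 - (b'.1 + x)‖ := by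
      have e : x = (a.1 - b'.1) - (a.1 - (b'.1 + x)) := by abel
      calc ‖x‖ = ‖(a.1 - b'.1) - (a.1 - (b'.1 + x))‖ := by rw [← e]
        _ ≤ ‖a.1 - b'.1‖ + ‖a.1 - (b'.1 + x)‖ := norm_sub_le _ _
    rw [← Site.norm_eq_supNorm x]
    linarith
  have hcard₁ : T₁.card ≤ n := by
    rw [hT₁]
    exact (card_union_biUnion_perturbedNbr_le hm S₁).trans (Nat.le_add_right _ _)
  have hcard₂ : T₂.card ≤ n := by
    rw [hT₂]
    exact ((card_union_biUnion_perturbedNbr_le hm S₂x).trans (Nat.mul_le_mul_left _ hS₂xcard)).trans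
      (Nat.le_add_left _ _)
  -- DLR smoothing: the three integrals are unchanged
  have hI₁ : ∫ U, F₁ U * Gx U ∂μ = ∫ U, f₁ U * g₂ U ∂μ := by
    have hS₁T₁ : ∀ e ∈ S₁, e ∈ T₁ := fun e he => by rw [hT₁]; exact Finset.mem_union_left _ he
    have hS₂T₂ : ∀ e ∈ S₂x, e ∈ T₂ := fun e he => by rw [hT₂]; exact Finset.mem_union_left _ he
    have ha : ∫ U, f₁ U * Gx U ∂μ = ∫ U, F₁ U * Gx U ∂μ :=
      integral_specAvg_mul hγ hGibbs S₁ h₁m hM₁ hGxm hGxM hGxS fun e he heS =>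
        hdisj e (hS₁T₁ e he) e (hS₂T₂ e (Finset.mem_coe.1 heS)) rfl
    have hb' : ∫ U, g₂ U * f₁ U ∂μ = ∫ U, Gx U * f₁ U ∂μ :=
      integral_specAvg_mul hγ hGibbs S₂x hGxm hGxM hf₁m hf₁M hf₁T fun e he heT =>
        hdisj e (Finset.mem_coe.1 heT) e (hS₂T₂ e he) rfl
    calc ∫ U, F₁ U * Gx U ∂μ = ∫ U, f₁ U * Gx U ∂μ := ha.symm
      _ = ∫ U, Gx U * f₁ U ∂μ := integral_congr_ae (ae_of_all _ fun U => mul_comm _ _)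
      _ = ∫ U, g₂ U * f₁ U ∂μ := hb'.symm
      _ = ∫ U, f₁ U * g₂ U ∂μ := integral_congr_ae (ae_of_all _ fun U => mul_comm _ _)
  have hI₂ : ∫ U, F₁ U ∂μ = ∫ U, f₁ U ∂μ := (integral_specAvg hγ hGibbs S₁ h₁m hM₁).symm
  have hI₃ : ∫ U, Gx U ∂μ = ∫ U, g₂ U ∂μ := (integral_specAvg hγ hGibbs S₂x hGxm hGxM).symm
  have hcov' : cov[F₁, fun U => F₂ (Literature.MathematicalPhysics.QuantumLattice.configShift x U); μ] = cov[f₁, g₂; μ] := by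
    rw [hcov, hI₁, hI₂, hI₃]
    exact (covariance_eq_sub (hL2 hf₁m hf₁M) (hL2 hg₂m hg₂M)).symm
  rw [hcov']
  have hcl' := hc₁ f₁ g₂ T₁ T₂ K₁ K₂ hcard₁ hcard₂ hdisjT hf₁L hg₂L
  have hL2₁ : Real.sqrt (∫ U, f₁ U ^ 2 ∂μ) ≤ M₁ := MassGapMassive.sqrt_integral_sq_le hf₁M
  have hL2₂ : Real.sqrt (∫ U, g₂ U ^ 2 ∂μ) ≤ M₂ := MassGapMassive.sqrt_integral_sq_le hg₂M
  have hB : (K₁ : ℝ) * K₂ + Real.sqrt (∫ U, f₁ U ^ 2 ∂μ) * Real.sqrt (∫ U, g₂ U ^ 2 ∂μ) ≤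
      (K₁ : ℝ) * K₂ + M₁ * M₂ :=
    add_le_add le_rfl (mul_le_mul hL2₁ hL2₂ (Real.sqrt_nonneg _) hM₁0)
  have hB0 : 0 ≤ (K₁ : ℝ) * K₂ + Real.sqrt (∫ U, f₁ U ^ 2 ∂μ) * Real.sqrt (∫ U, g₂ U ^ 2 ∂μ) := by
    positivity
  have hexp : Real.exp (-c * setDistEdges T₁ T₂) ≤ Kfar * Real.exp (-c * (Site.supNorm x : ℕ)) := by
    rw [hKfar, ← Real.exp_add]
    refine Real.exp_le_exp.2 ?_
    have := mul_le_mul_of_nonneg_left hdist hc.le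
    linarith
  refine hcl'.trans ?_
  calc c₁ * Real.exp (-c * setDistEdges T₁ T₂) *
        ((K₁ : ℝ) * K₂ + Real.sqrt (∫ U, f₁ U ^ 2 ∂μ) * Real.sqrt (∫ U, g₂ U ^ 2 ∂μ))
      ≤ c₁' * Real.exp (-c * setDistEdges T₁ T₂) *
        ((K₁ : ℝ) * K₂ + Real.sqrt (∫ U, f₁ U ^ 2 ∂μ) * Real.sqrt (∫ U, g₂ U ^ 2 ∂μ)) :=
        mul_le_mul_of_nonneg_right (mul_le_mul_of_nonneg_right (le_max_left _ _) (Real.exp_pos _).le) hB0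
    _ ≤ c₁' * (Kfar * Real.exp (-c * (Site.supNorm x : ℕ))) * ((K₁ : ℝ) * K₂ + M₁ * M₂) :=
        mul_le_mul (mul_le_mul_of_nonneg_left hexp hc₁'0) hB hB0
          (mul_nonneg hc₁'0 (mul_nonneg hKfar0.le hexp0.le))
    _ = A * Kfar * Real.exp (-c * (Site.supNorm x : ℕ)) := by rw [hAdef]; ring
    _ ≤ (2 * M₁ * M₂ + A) * Kfar * Real.exp (-c * (Site.supNorm x : ℕ)) := by
        refine mul_le_mul_of_nonneg_right (mul_le_mul_of_nonneg_right ?_ hKfar0.le) hexp0.le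
        exact le_add_of_nonneg_left (by positivity)

/-! ### Members of the tier-1 ball: the hypotheses from `MemBallZd` -/

/-- The one-link ranges of a member of `MemBallZd ε₀ ε₁ R` are based within `max 1 ⌈R⌉₊` of their link
(plaquette neighbours within `1`, listed sets within `R`). -/
theorem norm_sub_le_of_mem_perturbedNbr_of_range
    {supp : Finset (ZdEdge d) → Finset (Finset (ZdEdge d))} {R : ℝ}
    (hR : ∀ e, ∀ X ∈ supp {e}, e ∈ X → ∀ y ∈ X, ‖e.1 - y.1‖ ≤ R) (e : ZdEdge d) (y : ZdEdge d)
    (hy : y ∈ perturbedNbr supp e) : ‖e.1 - y.1‖ ≤ ((max 1 ⌈R⌉₊ : ℕ) : ℝ) := by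
  rcases (mem_perturbedNbr_iff.1 hy).2 with hy' | ⟨X, hX, heX, hyX⟩
  · exact (norm_sub_le_one_of_mem_linkPlaqNbr hy').trans (by exact_mod_cast le_max_left 1 ⌈R⌉₊)
  · exact ((hR e X hX heX y hyX).trans (Nat.le_ceil R)).trans (by exact_mod_cast le_max_right 1 ⌈R⌉₊)

/-- **Covariance decay of all bounded local observables under every DLR state of a MEMBER OF THE BALL
with the Lipschitz-cylinder clustering clause** (every `d ≥ 1`): the `MemBallZd ε₀ ε₁ R W supp` packaging of
`perturbed_covariance_decay_of_lipschitzClustering` (range bound `m = 6(d−1) + #box(⌊R⌋₊)·d`, collar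
radius `max 1 ⌈R⌉₊`). -/
theorem perturbed_covariance_decay_of_memBallZd (hd : 1 ≤ d) (hN : 1 ≤ N) (b : ℝ) {ε₀ ε₁ R : ℝ}
    {W : Potential (ZdEdge d) (Matrix.specialUnitaryGroup (Fin N) ℂ)}
    {supp : Finset (ZdEdge d) → Finset (Finset (ZdEdge d))} (hmem : MemBallZd ε₀ ε₁ R W supp)
    {μ : Measure (LGConfig d (Matrix.specialUnitaryGroup (Fin N) ℂ))}
    (hμ : μ ∈ perturbedGibbsMeasures (d := d) (fundamentalRep (Fin N)) b W supp) {c : ℝ} (hc : 0 < c)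
    (hcl : ∀ n : ℕ, ∃ c₁ : ℝ,
      ∀ (G₁ G₂ : LGConfig d (Matrix.specialUnitaryGroup (Fin N) ℂ) → ℝ)
        (Λ₁ Λ₂ : Finset (ZdEdge d)) (K₁ K₂ : ℝ≥0),
        Λ₁.card ≤ n → Λ₂.card ≤ n → Disjoint Λ₁ Λ₂ →
        IsLipschitzCylinder (fundamentalRep (Fin N)) G₁ Λ₁ K₁ →
        IsLipschitzCylinder (fundamentalRep (Fin N)) G₂ Λ₂ K₂ →
          |cov[G₁, G₂; μ]| ≤ c₁ * Real.exp (-c * setDistEdges Λ₁ Λ₂) *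
            ((K₁ : ℝ) * K₂ + Real.sqrt (∫ U, G₁ U ^ 2 ∂μ) * Real.sqrt (∫ U, G₂ U ^ 2 ∂μ)))
    (F₁ F₂ : LGConfig d (Matrix.specialUnitaryGroup (Fin N) ℂ) → ℝ)
    (h₁ : Literature.MathematicalPhysics.QuantumLattice.IsLocalObservable F₁)
    (h₂ : Literature.MathematicalPhysics.QuantumLattice.IsLocalObservable F₂) (h₁m : Measurable F₁) (h₂m : Measurable F₂)
    (hb₁ : ∃ C, ∀ U, |F₁ U| ≤ C) (hb₂ : ∃ C, ∀ U, |F₂ U| ≤ C) :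
    ∃ C : ℝ, ∀ x : Site d, |cov[F₁, fun U => F₂ (Literature.MathematicalPhysics.QuantumLattice.configShift x U); μ]| ≤ C * Real.exp (-c * ‖x‖) := by
  obtain ⟨osc, lip, -, hlip, -, hΛ⟩ := hmem.loads
  exact perturbed_covariance_decay_of_lipschitzClustering hd hN b
    (fun X => (hmem.continuous X).measurable) (fun X => exists_bound_of_continuous (hmem.continuous X))
    hmem.dependsOn hmem.supportedBy hlip hΛ (card_perturbedNbr_le_of_range hmem.range)
    (norm_sub_le_of_mem_perturbedNbr_of_range hmem.range) hμ hc hcl F₁ F₂ h₁ h₂ h₁m h₂m hb₁ hb₂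

end Summit.Ventures.YMGap.RobustBall

end
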